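import Literature.Barriers.SmoothPoincare4.OneStabilisationContractibleCorkProofs
import Literature.Barriers.SmoothPoincare4.ExoticContractibleKangProofs
import HarnessLib

/-!
# The master statement `OneStabilisationSufficesContractible` is the negation of Kang's Cor. 1.2

Third sibling proof file of `Literature/Barriers/SmoothPoincare4/OneStabilisationContractible.lean`
(D-0021 barrier `OneStabilisationBarrier := ¬ OneStabilisationSufficesContractible`, proved there
from the named fact `kang2022_corollary12`; `OneStabilisationContractibleProofs.lean` and
`OneStabilisationContractibleCorkProofs.lean` take Cor. 1.2 down to the leaves of its printed
proof), companion to `ExoticContractibleRigidityProofs.lean`, which does the same for the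
unstabilised master statement `ContractibleRigidityFour` of `ExoticContractible.lean`.

The master statement `OneStabilisationSufficesContractible` ("homeomorphic compact contractible
smooth 4-manifolds with diffeomorphic boundaries become diffeomorphic after one connected sum with
`S² × S²`", for all connected sums in the tree's relational sense) is, by pushing the negation
through its binders, exactly the statement that no pair `(W₁, W₂)` as in Kang's Cor. 1.2 exists
(`oneStabilisationSufficesContractible_iff_not_kang2022_corollary12`). Consequently
`OneStabilisationSufficesContractible` is not a dischargeable fact: it is REFUTED by the very
result its docstring cites — a proof of `OneStabilisationSufficesContractible` would be a
disproof of "Corollary 1.2. There exist homeomorphic smooth contractible 4-manifolds `W₁`, `W₂`,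
with diffeomorphic boundaries, such that `W₁ ♯ (S² × S²)` and `W₂ ♯ (S² × S²)` are not
diffeomorphic." as rendered in the tree (`kang2022_corollary12`). It stays a definition because it
is the formal technique class of the barrier (D-0021: "the technique class as an explicit Lean
definition"); its `[cite]` tag points at the result that refutes it.

The file also places the master statement among its neighbours, modulo named facts of the tree
(every arrow below is proved):

* relative to the leaves of Kang's printed proof of Cor. 1.2 (§5) it says that the pair `(V, V′)`
  of that proof does not exist (`oneStabilisationSufficesContractible_iff_not_exoticPair`, with
  Freedman–Quinn 11.1C making `V`, `V′` homeomorphic), and hence that NO cork survives one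
  stabilisation, i.e. Kang's Thm. 1.1 fails
  (`not_kang2022_theorem11_of_oneStabilisationSuffices`, with the stabilised Akbulut–Ruberman
  construction and Freedman–Quinn; the pointwise form is
  `extendsOverStabilisation_of_oneStabilisationSuffices` of the cork-level sibling file);
* it is IMPLIED by the unstabilised master statement `ContractibleRigidityFour` ("homeomorphic
  compact contractible smooth 4-manifolds with diffeomorphic boundaries are diffeomorphic",
  refuted by Akbulut–Ruberman's Thm. B) as soon as the stabilisation `W ♯ (S² × S²)` is well
  defined up to diffeomorphism (`oneStabilisationSufficesContractible_of_contractibleRigidityFour`,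
  the contrapositive of `contractibleBarrierFour_of_oneStabilisationBarrier` of
  `ExoticContractibleKangProofs.lean`): one-stabilisation rigidity is the WEAKER technique
  statement, so its failure (Kang) is the stronger barrier.

## What is printed

* Kang (arXiv:2210.07510v3), p. 1: "Theorem 1.1. There exists a cork `(Y, W, f)` such that `f`
  does not extend to a self-diffeomorphism of `W ♯ (S² × S²)`." "Then, by following the arguments
  of [AR16], one can also prove the existence of an absolutely exotic pair of contractible
  4-manifolds which remains absolutely exotic after one stabilization. Corollary 1.2. There exist
  homeomorphic smooth contractible 4-manifolds `W₁`, `W₂`, with diffeomorphic boundaries, such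
  that `W₁ ♯ (S² × S²)` and `W₂ ♯ (S² × S²)` are not diffeomorphic."; proof of Cor. 1.2 (§5,
  pp. 20–21): "we consider the 4-manifolds `V = W ∪ X`, `V′ = W ∪_f X`, which are
  simply-connected homology balls by [AR16, Proposition 2.6], so that they are contractible,
  hence homeomorphic. Then one can simply follow the remaining part of the proof of [AR16,
  Theorem A] to conclude that there exists no diffeomorphism between `V ♯ (S² × S²)` and
  `V′ ♯ (S² × S²)`."
* Akbulut–Ruberman 2016 (Comment. Math. Helv. 91), Thm. B: "There are compact contractible smooth
  4-manifolds `V` and `V′` with diffeomorphic boundaries, such that they are homeomorphic but not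
  diffeomorphic to each other."
* Kosinski 1993, Ch. VI Thm. (1.1) (the connected sum of connected manifolds is well defined up to
  diffeomorphism), as quoted in `ExoticContractibleKangProofs.lean`.

No definition and no named fact is introduced here; all hypotheses are the tree's named facts
`kang2022_corollary12` (`OneStabilisationContractible.lean`),
`kang2022_oneStabilisationExoticPair`, `freedmanQuinn1990_homeomorph_extends_contractible`
(`OneStabilisationContractibleProofs.lean`, `ExoticContractibleProofs.lean`), `kang2022_theorem11`,
`kang2022_akbulutRubermanStabilised` (`OneStabilisationContractibleCorkProofs.lean`),
`nonempty_diffeomorph_of_isConnectedSum_sphereTwoProd` (`ExoticContractibleKangProofs.lean`) and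
the master statement `ContractibleRigidityFour` (`ExoticContractible.lean`). Universe `0`
throughout, as in the barrier file.

## References

[Kang2022OneStabilization] [AkbulutRuberman2016] [FreedmanQuinn1990] [Kosinski1993]
-/

noncomputable section

open scoped Manifold ContDiff

namespace Literature.Barriers.SmoothPoincare4

/-! ### The master statement is the negation of Cor. 1.2 -/

/-- **The master statement is the negation of Kang's Cor. 1.2 (as rendered)**:
`OneStabilisationSufficesContractible ↔ ¬ kang2022_corollary12` (from
`oneStabilisationBarrier_iff_kang2022_corollary12` and `not_not`; classical logic only). In
particular `OneStabilisationSufficesContractible` is refuted, not open, relative to Literature: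
discharging it would disprove "There exist homeomorphic smooth contractible 4-manifolds `W₁`,
`W₂`, with diffeomorphic boundaries, such that `W₁ ♯ (S² × S²)` and `W₂ ♯ (S² × S²)` are not
diffeomorphic" as rendered in the tree (`kang2022_corollary12`).
[cite: Kang2022OneStabilization, Cor. 1.2] -/
theorem oneStabilisationSufficesContractible_iff_not_kang2022_corollary12 :
    OneStabilisationSufficesContractible ↔ ¬ kang2022_corollary12 := by
  rw [← oneStabilisationBarrier_iff_kang2022_corollary12, OneStabilisationBarrier, not_not]

/-- **Kang's Cor. 1.2 refutes the master statement**: `kang2022_corollary12 →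
¬ OneStabilisationSufficesContractible` (the barrier `oneStabilisationBarrier_of_kang`, restated
at the master statement). [cite: Kang2022OneStabilization, Cor. 1.2] -/
theorem not_oneStabilisationSufficesContractible_of_kang (hK : kang2022_corollary12) :
    ¬ OneStabilisationSufficesContractible :=
  oneStabilisationBarrier_of_kang hK

/-! ### The master statement against the leaves of Kang's proof -/

/-- **With Freedman–Quinn, the master statement is the non-existence of the pair `(V, V′)` of
Kang's proof of Cor. 1.2**: given Freedman–Quinn 11.1C for the trivial group (hypothesis `hF`:
compact contractible 4-manifolds with homeomorphic boundaries are homeomorphic — "so that they are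
contractible, hence homeomorphic"), `OneStabilisationSufficesContractible ↔
¬ kang2022_oneStabilisationExoticPair` (through `kang2022_corollary12_iff_exoticPair`).
[cite: Kang2022OneStabilization, proof of Cor. 1.2 (§5)] [cite: FreedmanQuinn1990, Prop. 11.1C (trivial group) and Cor. 9.3C] -/
theorem oneStabilisationSufficesContractible_iff_not_exoticPair
    (hF : freedmanQuinn1990_homeomorph_extends_contractible.{0}) :
    OneStabilisationSufficesContractible ↔ ¬ kang2022_oneStabilisationExoticPair := by
  rw [oneStabilisationSufficesContractible_iff_not_kang2022_corollary12,
    kang2022_corollary12_iff_exoticPair hF]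

/-- **Under the master statement no cork survives one stabilisation** — Kang's Thm. 1.1 fails —
modulo the stabilised Akbulut–Ruberman construction (hypothesis `hAR`: a boundary diffeomorphism
of a compact contractible smooth `W` extending over no `W ♯ (S² × S²)` yields compact contractible
`V`, `V′` with `∂V ≅ ∂V′` and non-diffeomorphic stabilisations) and Freedman–Quinn 11.1C
(hypothesis `hF`): `OneStabilisationSufficesContractible → ¬ kang2022_theorem11`. This is the
printed implication "Thm. 1.1 ⇒ Cor. 1.2" (§5) read contrapositively, through
`extendsOverStabilisation_of_oneStabilisationSuffices`: every boundary diffeomorphism of every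
compact contractible smooth 4-manifold would extend over some `W ♯ (S² × S²)`.
[cite: Kang2022OneStabilization, Thm. 1.1 and proof of Cor. 1.2 (§5)] [cite: AkbulutRuberman2016, proof of Thm. A (§3)] -/
theorem not_kang2022_theorem11_of_oneStabilisationSuffices (h : OneStabilisationSufficesContractible)
    (hAR : kang2022_akbulutRubermanStabilised)
    (hF : freedmanQuinn1990_homeomorph_extends_contractible.{0}) : ¬ kang2022_theorem11 := by
  rintro ⟨W, _, _, _, _, _, _, _, b, f, -, hS⟩
  exact hS (extendsOverStabilisation_of_oneStabilisationSuffices h hAR hF b f)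

/-! ### One-stabilisation rigidity is weaker than rigidity -/

-- `linter.deprecated` is off for the next declaration only: it must name the master statement
-- (`RelativeContractibleRigidityFour` / `ContractibleRigidityFour`, kept verbatim in `ExoticContractible.lean`
-- but deprecated AS A NAMED FACT, verdict clean-up 2026-08-15) in order to characterise it.
set_option linter.deprecated false in
/-- **Absolute rigidity implies one-stabilisation rigidity, once `W ♯ (S² × S²)` is well
defined.** Assume the stabilisation of a compact connected smooth 4-manifold with boundary is well
defined up to diffeomorphism (hypothesis `hU`, Kosinski VI.(1.1) with the orientation-reversing
symmetry of `S² × S²`). If homeomorphic compact contractible smooth 4-manifolds with diffeomorphic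
boundaries were always diffeomorphic (`ContractibleRigidityFour`, the unstabilised master statement
of `ExoticContractible.lean`, at universe `0`), then all their connected sums with `S² × S²` would
be diffeomorphic (`OneStabilisationSufficesContractible`): a diffeomorphism `W₁ ≅ W₂` carries any
stabilisation of `W₁` to a stabilisation of `W₂` (`nonempty_diffeomorph_stabilisation_of_diffeomorph`;
`W₂` is connected because contractible). Contrapositively Kang's barrier implies Akbulut–Ruberman's
(`contractibleBarrierFour_of_oneStabilisationBarrier`): "an absolutely exotic pair of contractible
4-manifolds which remains absolutely exotic after one stabilization" (Kang, §1) is in particular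
an absolutely exotic pair. [cite: Kang2022OneStabilization, §1 and Cor. 1.2] [cite: Kosinski1993, Ch. VI §1 Thm. (1.1)] -/
theorem oneStabilisationSufficesContractible_of_contractibleRigidityFour
    (hU : nonempty_diffeomorph_of_isConnectedSum_sphereTwoProd)
    (h : ContractibleRigidityFour.{0}) : OneStabilisationSufficesContractible := by
  intro W₁ W₂ _ _ _ _ _ _ _ _ _ _ _ _ _ _ b₁ b₂ hB hW P₁ P₂ _ _ _ _ _ _ _ _ _ _ hP₁ hP₂
  obtain ⟨e⟩ := h W₁ W₂ b₁ b₂ hB hW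
  exact nonempty_diffeomorph_stabilisation_of_diffeomorph hU hP₁ hP₂ e

-- `linter.deprecated` is off for the next declaration only: it must name the master statement
-- (`RelativeContractibleRigidityFour` / `ContractibleRigidityFour`, kept verbatim in `ExoticContractible.lean`
-- but deprecated AS A NAMED FACT, verdict clean-up 2026-08-15) in order to characterise it.
set_option linter.deprecated false in
/-- **The two master statements are jointly refuted in order**: given well-definedness of the
stabilisation (`hU`), Kang's Cor. 1.2 refutes BOTH `OneStabilisationSufficesContractible` and
`ContractibleRigidityFour.{0}` (the latter through
`oneStabilisationSufficesContractible_of_contractibleRigidityFour`; equivalently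
`contractibleBarrierFour_of_kang`). [cite: Kang2022OneStabilization, §1 and Cor. 1.2] -/
theorem not_contractibleRigidityFour_of_kang (hK : kang2022_corollary12)
    (hU : nonempty_diffeomorph_of_isConnectedSum_sphereTwoProd) : ¬ ContractibleRigidityFour.{0} :=
  fun h => not_oneStabilisationSufficesContractible_of_kang hK
    (oneStabilisationSufficesContractible_of_contractibleRigidityFour hU h)

end Literature.Barriers.SmoothPoincare4

end
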